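import Summits.ResolutionOfSingularities.ResolutionOfSingularities.Theses.SectionAscent
import Literature.AlgebraicGeometry.Resolution.AffineBlowupRegular

/-!
# `AffineToGlobal` — negative lemmas I: what a refutation must be; the one-shot hypothesis is
# tight on regular varieties and not junk-satisfiable/junk-refutable at its base

Support (negative-side) lemmas for crux `stmt-ResolutionOfSingularities-15961`
(`Summit.ResolutionOfSingularities.ResolutionOfSingularities.Theses.SectionAscent.AffineToGlobal`:
for every prime `p`, affine one-shot strong resolution `OneShot p d` in every dimension `d` ⇒
`ResolutionInChar p`), filed by the crux disprover (cdisprove cycle 1, 2026-08-17). This file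
declares NO definition (the `let`-bound predicate `OneShot` of the route file is written out
inline) and NO declaration concludes the route decl positively.

* `not_affineToGlobal_iff` — **load-bearing analysis**: `¬ AffineToGlobal` is equivalent to the
  existence of a prime `p` with affine one-shots in all dimensions AND `¬ ResolutionInChar p`;
  dropping the one-shot hypothesis leaves literally the summit, so no `_false_without_` lemma for
  this crux can exist unless the summit fails at some prime (recorded for planners: the crux is
  unfalsifiable short of a counterexample to resolution in characteristic `p`).
* `centre_ne_bot_of_centre_iff` — **the conjunct `I ≠ ⊥` of `OneShot` is decoration**: it follows
  from the clause `∀ 𝔭, I ≤ 𝔭 ↔ ¬ IsRegularLocalRing A_𝔭` (the zero ideal of a domain is prime and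
  `A_{(0)}` is a field). Provers of the sibling cruxes `GenericLevel` / `FibrewiseClosedPoints`,
  who must EXHIBIT `I`, get `I ≠ ⊥` for free.
* `centre_eq_top_of_isRegularRing` — **tightness on regular varieties**: if `A` is a regular ring
  the same clause forces `I = ⊤`; with `isRegular_affineBlowup_top` (`Bl_⊤(Spec A) = Proj A[t]`
  is regular for regular `A`, from the tree's `affineBlowup.isRegular_of_isQuasiRegular` at the
  quasi-regular sequence `(1)`, `isQuasiRegular_one`) this gives
  `oneShot_witness_of_isRegularRing`: on a regular integral affine variety the one-shot clause is
  satisfiable, by the unit ideal and only by it. Consequence: the hypothesis family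
  `∀ d, OneShot p d` is not junk-false at its base (`d ≤ 1`, regular `A`), so `AffineToGlobal` is
  not vacuously provable from a formalisation accident; its content is the genuine
  local-to-global step.

## Sources
* Q. Liu, *Algebraic Geometry and Arithmetic Curves*, OUP 2002, Thm. 8.1.19 (a), as proved in the
  tree (`affineBlowup.isRegular_of_isQuasiRegular`).
* V. Cossart, O. Piltant, J. Algebra 529 (2019), Thm. 1.1 and p. 3 (the one-shot statement).
-/

noncomputable section

set_option linter.dupNamespace false -- mandated namespace of this single-conjunct summit

open CategoryTheory AlgebraicGeometry
open Literature.AlgebraicGeometry.Resolution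
open Summit.ResolutionOfSingularities.ResolutionOfSingularities.Theses.SectionAscent (AffineToGlobal)

namespace Summit.ResolutionOfSingularities.ResolutionOfSingularities.Theorems.AffineToGlobal.Negative

/-- **What a refutation of `AffineToGlobal` would have to be**: a prime `p` at which affine
one-shot strong resolution holds in every dimension while resolution of singularities in
characteristic `p` fails (in particular, a counterexample to the summit at `p`). The `let`-bound
`OneShot` of the route file is written out. [folklore] -/
theorem not_affineToGlobal_iff :
    ¬ AffineToGlobal ↔ ∃ p : ℕ, p.Prime ∧
      (∀ d : ℕ, ∀ (K : Type) [Field K] [CharP K p] (A : Type) [CommRing A] [IsDomain A]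
        [Algebra K A] [Algebra.FiniteType K A], ringKrullDim A < (d : WithBot ℕ∞) →
        ∃ I : Ideal A, I ≠ ⊥ ∧ Scheme.IsRegular (affineBlowup I) ∧
          ∀ 𝔭 : PrimeSpectrum A, I ≤ 𝔭.asIdeal ↔
            ¬ IsRegularLocalRing (Localization.AtPrime 𝔭.asIdeal)) ∧
      ¬ ResolutionInChar.{0} p := by
  unfold AffineToGlobal
  dsimp only
  push Not
  rfl

/-- The localisation of a domain at the zero ideal is a field, hence a regular local ring.
[folklore] -/
theorem isRegularLocalRing_localization_bot (A : Type*) [CommRing A] [IsDomain A] :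
    IsRegularLocalRing (Localization.AtPrime (⊥ : Ideal A)) := by
  let _ : Field (Localization.AtPrime (⊥ : Ideal A)) := IsField.toField <| by
    simp [IsLocalRing.isField_iff_maximalIdeal_eq, ← Localization.AtPrime.map_eq_maximalIdeal]
  infer_instance

/-- **The conjunct `I ≠ ⊥` of the one-shot hypothesis is decoration**: it follows from the clause
`V(I) = Sing` alone, because the generic point of an integral affine scheme is regular.
[folklore] -/
theorem centre_ne_bot_of_centre_iff {A : Type*} [CommRing A] [IsDomain A] {I : Ideal A}
    (h : ∀ 𝔭 : PrimeSpectrum A, I ≤ 𝔭.asIdeal ↔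
      ¬ IsRegularLocalRing (Localization.AtPrime 𝔭.asIdeal)) : I ≠ ⊥ := by
  rintro rfl
  exact (h ⟨⊥, Ideal.isPrime_bot⟩).mp le_rfl (isRegularLocalRing_localization_bot A)

/-- **On a regular ring the clause `V(I) = Sing` forces the unit ideal**: the only admissible
one-shot centre of a regular integral affine variety is `I = ⊤`. [folklore] -/
theorem centre_eq_top_of_isRegularRing {A : Type*} [CommRing A] [IsRegularRing A] {I : Ideal A}
    (h : ∀ 𝔭 : PrimeSpectrum A, I ≤ 𝔭.asIdeal ↔
      ¬ IsRegularLocalRing (Localization.AtPrime 𝔭.asIdeal)) : I = ⊤ := by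
  by_contra hI
  obtain ⟨M, hM, hIM⟩ := Ideal.exists_le_maximal I hI
  exact (h ⟨M, hM.isPrime⟩).mp hIM inferInstance

/-- The one-element sequence `(1)` is quasi-regular (its ideal is the unit ideal, so the
coefficient condition is empty). [folklore] -/
theorem isQuasiRegular_one (A : Type*) [CommRing A] : IsQuasiRegular ![(1 : A)] := by
  intro n F _ _
  have htop : Ideal.span (Set.range ![(1 : A)]) = ⊤ :=
    (Ideal.eq_top_iff_one _).mpr (Ideal.subset_span ⟨0, rfl⟩)
  rw [htop, Ideal.map_top]
  trivial

/-- **`Bl_⊤(Spec A) = Proj A[t]` is regular for a regular ring `A`** (Liu 8.1.19 (a) in the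
tree's affine quasi-regular form, at the sequence `(1)`: `A/(1) = 0` is a regular ring
vacuously). [cite: Liu2002, Thm. 8.1.19 (a)] -/
theorem isRegular_affineBlowup_top (A : Type*) [CommRing A] [IsRegularRing A] :
    Scheme.IsRegular (affineBlowup (⊤ : Ideal A)) := by
  have htop : Ideal.span (Set.range ![(1 : A)]) = ⊤ :=
    (Ideal.eq_top_iff_one _).mpr (Ideal.subset_span ⟨0, rfl⟩)
  haveI : Subsingleton (A ⧸ Ideal.span (Set.range ![(1 : A)])) :=
    Ideal.Quotient.subsingleton_iff.mpr htop
  haveI : IsRegularRing (A ⧸ Ideal.span (Set.range ![(1 : A)])) :=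
    { isRegularLocalRing_localization := fun p hp =>
        (hp.ne_top (Subsingleton.elim p ⊤)).elim }
  have h := affineBlowup.isRegular_of_isQuasiRegular ![(1 : A)] (isQuasiRegular_one A)
  rwa [htop] at h

/-- **The one-shot clause is satisfiable on every regular integral affine variety, by `I = ⊤`**
(and only by it, `centre_eq_top_of_isRegularRing`). [folklore] -/
theorem oneShot_witness_of_isRegularRing (A : Type*) [CommRing A] [IsDomain A]
    [IsRegularRing A] :
    ∃ I : Ideal A, I ≠ ⊥ ∧ Scheme.IsRegular (affineBlowup I) ∧
      ∀ 𝔭 : PrimeSpectrum A, I ≤ 𝔭.asIdeal ↔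
        ¬ IsRegularLocalRing (Localization.AtPrime 𝔭.asIdeal) := by
  refine ⟨⊤, top_ne_bot, isRegular_affineBlowup_top A, fun 𝔭 => ⟨fun h => ?_, fun h => ?_⟩⟩
  · exact (𝔭.isPrime.ne_top (top_le_iff.mp h)).elim
  · exact (h inferInstance).elim

end Summit.ResolutionOfSingularities.ResolutionOfSingularities.Theorems.AffineToGlobal.Negative

end
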